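import Summits.KontsevichZagierPeriods.KontsevichZagierPeriods.Theses.CompiledSubstitutions
import Summits.KontsevichZagierPeriods.KontsevichZagierPeriods.Theorems.CompiledSubstitutionsZetaEvenBKC
import Summits.KontsevichZagierPeriods.KontsevichZagierPeriods.Theorems.CompiledSubstitutionsCompiledSectorGlue
import Summits.KontsevichZagierPeriods.KontsevichZagierPeriods.Theorems.AyoubSpecialisationAyoubThesisV2KernelPiSplit
import Summits.KontsevichZagierPeriods.KontsevichZagierPeriods.Theorems.HermiteRigidityReductionRigidityFrame
import Literature.NumberTheory.Transcendental.KZKernelConjectureForms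
import Literature.NumberTheory.Transcendental.KZVolumeConjectureProofs
import Literature.NumberTheory.Transcendental.KZLogCalculusProofs
import Literature.NumberTheory.Transcendental.KZProduct

/-!
# Strategist census (typed part) — crux `AlgebraicFormTarget` (stmt-KontsevichZagierPeriods-3380)

Route `route-KontsevichZagierPeriods-CompiledSubstitutions`, re-audit bin RESTATED (docs/m5/ROUTE-REAUDIT-2026-08-17.md,
row 1155). Companion of `STRATEGY-CENSUS.md` in the same crux directory: every decomposition of the
crux that was attempted is TYPED here, and the reason it violates one of the BC2-redirect conditions
(a) load-bearing / (b) proved NON-TRIVIAL assembly / (c) no piece equivalent to the crux or the summit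
is a kernel-checked statement wherever it is a mathematical (rather than administrative) reason.

Contents
* §0 the crux IS the summit (`crux_iff_summit`, `crux_iff_kernel`; both are tree theorems re-exported);
* §1 D0, the split already filed on the route (sector ∧ `CompiledSectorKernel`): its seam is ONE line
  (`d0_seam`, verbatim the landed `compiledSectorGlue_proof`) — violates (b); and
  `CompiledSectorKernel` is the crux modulo the three open sector cruxes (`csk_of_crux` one line,
  `csk_iff_crux_of_sector`) — violates (c) in substance;
* §2 the SANDWICH LEMMA: every decomposition through an intermediate module of relations
  `relations ≤ R ≤ ker eval` ("Conjecture 1 for an extended calculus" ∧ "the extension is derivable")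
  has the assembly `le_trans` (`Extension.kernel_of_complete_of_conservative`, one line) — violates (b)
  by construction — and both pieces are consequences of the crux; the two degenerate ends
  (`R = relations`: completeness ≡ crux; `R = ker eval`: conservativity ≡ crux) are `bot_*`, `top_*`;
* §3 the META-FACT (`metaFact`): in any split whose other pieces are provable the last piece is
  equivalent to the crux — the shape that kills every "normal form ∧ decision" split here, because the
  normal forms ARE tree theorems (Viu-Sos' reduction `KZ.semiCanonicalReduction_holds`);
* §4 D1 volume form: `crux_iff_volumeConjectureCompact` (tree theorem) and the LANDED iff of the shared
  item `VolumeForm` (`volumeForm_landed_iff`) — violates (c) mechanically ("landed iff");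
* §5 D2 π-localisation: `crux_iff_piSplit` — the one split in the tree passing (a)(b)(c), but it is route
  AyoubSpecialisation's thesis (items 0540/0541), not filable here (D-0019, `no_new_routes`);
* §6 D8 restriction classes: `crux_iff_zeroForm` — any class of pairs that contains the value-`0`
  representations against the empty representation is already the whole conjecture, so "Conjecture 1
  restricted to {algebraic values / positive integrands / connected domains / …}" never yields a piece
  strictly below the crux.

Nothing here is an item, a stub or a line; no `sorry`.
-/

noncomputable section

-- single-conjunct summit: Sub = Summit, so the namespace segment repeats by design (CONVENTIONS §2)
set_option linter.dupNamespace false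

namespace Summit.KontsevichZagierPeriods.KontsevichZagierPeriods.Cruxes.AlgebraicFormTarget.Census

open Literature.NumberTheory.Transcendental
open Literature.NumberTheory.Transcendental.KZ
open Summit.KontsevichZagierPeriods.KontsevichZagierPeriods.Theses.CompiledSubstitutions

/-! ## §0 The crux is the summit -/

/-- The crux is verbatim the tree's all-semialgebraic two-representation form `KZPeriodConjecture'`. -/
theorem crux_iff_kzPeriodConjecture' : AlgebraicFormTarget ↔ KZPeriodConjecture' := Iff.rfl

/-- The crux is equivalent to the summit `KontsevichZagierPeriods` (tree theorem
`kzPeriodConjecture'_iff_isRational`, whose right-hand side is the summit's body). -/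
theorem crux_iff_summit : AlgebraicFormTarget ↔ KontsevichZagierPeriods :=
  kzPeriodConjecture'_iff_isRational.trans KontsevichZagierPeriods_iff.symm

/-- The crux is equivalent to the kernel form `ker eval = relations`. -/
theorem crux_iff_kernel : AlgebraicFormTarget ↔ KZKernelConjecture :=
  kzKernelConjecture_iff_kzPeriodConjecture'.symm

/-! ## §1 D0 — the split filed on the route: sector ∧ `CompiledSectorKernel` -/

/-- **(b) fails for D0.** The assembly of the filed split is ONE line (this is verbatim the landed
`compiledSectorGlue_proof`, Theorems/CompiledSubstitutionsCompiledSectorGlue.lean): instantiate the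
kernel hypothesis at `S := relations`. -/
theorem d0_seam : LegendreSector → ZhouWanKPrimeCubed → ZetaEvenBKC → EulerReflectionRational →
    CompiledSectorKernel → AlgebraicFormTarget := by
  intro hL hZ hE hR hK n m r r' hv
  exact hK _ le_rfl hL hZ hE hR r r' hv

/-- The landed glue item is literally that seam. -/
example : CompiledSectorGlue := Summit.KontsevichZagierPeriods.KontsevichZagierPeriods.Theorems.compiledSectorGlue_proof

/-- **(c) fails for D0 in substance, first half:** the crux implies `CompiledSectorKernel` in one line
(any `S ≥ relations` contains every `[r] − [r']` that is a relation; the four realisability hypotheses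
are not even used). -/
theorem csk_of_crux (h : AlgebraicFormTarget) : CompiledSectorKernel := by
  intro S hS _ _ _ _ n m r r' hv
  exact hS (h r r' hv)

/-- **(c) fails for D0 in substance, second half:** modulo the three OPEN sector cruxes (rank 2
`LegendreSector`, rank 3 `ZhouWanKPrimeCubed`, rank 5 `EulerReflectionRational`; rank 4 `ZetaEvenBKC`
is the tree theorem `zetaEvenBKC_proof`) the piece `CompiledSectorKernel` is EQUIVALENT to the crux,
hence to the summit: "Conjecture 1 modulo a thin sector". -/
theorem csk_iff_crux_of_sector (hL : LegendreSector) (hZ : ZhouWanKPrimeCubed)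
    (hR : EulerReflectionRational) : CompiledSectorKernel ↔ AlgebraicFormTarget :=
  ⟨fun hK => d0_seam hL hZ
      Summit.KontsevichZagierPeriods.Theorems.CompiledSubstitutionsZetaEvenBKC.zetaEvenBKC_proof hR hK,
    csk_of_crux⟩

/-- Same, against the summit. -/
theorem csk_iff_summit_of_sector (hL : LegendreSector) (hZ : ZhouWanKPrimeCubed)
    (hR : EulerReflectionRational) : CompiledSectorKernel ↔ KontsevichZagierPeriods :=
  (csk_iff_crux_of_sector hL hZ hR).trans crux_iff_summit

/-! ## §2 The sandwich lemma

Every decomposition "Conjecture 1 for an extended calculus KZ⁺" ∧ "KZ⁺ is derivable in KZ" is an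
intermediate module of relations `relations ≤ R ≤ ker eval`; its assembly is `le_trans`. -/

/-- An *extension of the calculus*, seen through its module of relations on the same formal group:
sound (`R ≤ ker eval`) and containing the four moves (`relations ≤ R`). Instances: the π-saturation
`{c | ∃ N, [π]^N c ∈ relations}` (D2), `relations ⊔ closure (extra relators)` (every
"kernel-modulo-sector" crux of the summit), the relations of chains through ℝ_an-definable /
real-semialgebraic / motivic intermediate data restricted to `FormalRep` (D3/D4, routes
DefinableMoves, NoriTransfer). -/
structure Extension where
  /-- the relations of the extended calculus, restricted to formal combinations of KZ representations -/
  R : AddSubgroup FormalRep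
  /-- the four moves are moves of the extension -/
  relations_le : relations ≤ R
  /-- the extension is sound -/
  le_ker : R ≤ eval.ker

namespace Extension

/-- "Conjecture 1 for the extended calculus": every formal combination of value `0` is an
extended relation. -/
def Complete (E : Extension) : Prop := eval.ker ≤ E.R

/-- "The extension is derivable": every extended relation is a KZ relation. -/
def Conservative (E : Extension) : Prop := E.R ≤ relations

/-- **The seam of every sandwich decomposition is one line** (violates (b) by construction). -/
theorem kernel_of_complete_of_conservative (E : Extension) (h₁ : E.Complete) (h₂ : E.Conservative) :
    KZKernelConjecture := by
  intro c hc
  exact h₂ (h₁ (by rwa [AddMonoidHom.mem_ker]))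

/-- Completeness of any extension is a consequence of the kernel conjecture. -/
theorem complete_of_kernel (E : Extension) (h : KZKernelConjecture) : E.Complete := by
  intro c hc
  rw [AddMonoidHom.mem_ker] at hc
  exact E.relations_le (h c hc)

/-- Conservativity of any (sound) extension is a consequence of the kernel conjecture. -/
theorem conservative_of_kernel (E : Extension) (h : KZKernelConjecture) : E.Conservative := by
  intro c hc
  have hk := E.le_ker hc
  rw [AddMonoidHom.mem_ker] at hk
  exact h c hk

/-- The sandwich is TIGHT: the two pieces conjoin exactly to the kernel conjecture (= the crux,
`crux_iff_kernel`). So (c) holds for a sandwich iff BOTH pieces are open — and then (b) fails. -/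
theorem complete_and_conservative_iff (E : Extension) :
    (E.Complete ∧ E.Conservative) ↔ KZKernelConjecture :=
  ⟨fun h => E.kernel_of_complete_of_conservative h.1 h.2,
    fun h => ⟨E.complete_of_kernel h, E.conservative_of_kernel h⟩⟩

/-- Same, against the crux. -/
theorem complete_and_conservative_iff_crux (E : Extension) :
    (E.Complete ∧ E.Conservative) ↔ AlgebraicFormTarget :=
  E.complete_and_conservative_iff.trans crux_iff_kernel.symm

/-- The thin end: no extension at all. -/
def bot : Extension := ⟨relations, le_rfl, relations_le_ker_eval_holds⟩

/-- The thick end: everything of value `0` is an extended relation. -/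
def top : Extension := ⟨eval.ker, relations_le_ker_eval_holds, le_rfl⟩

/-- At the thin end conservativity is trivial … -/
theorem bot_conservative : bot.Conservative := le_rfl

/-- … and completeness IS the kernel conjecture (the "kernel modulo a thin sector" phenomenon in the
limit of an empty sector). -/
theorem bot_complete_iff : bot.Complete ↔ KZKernelConjecture :=
  ⟨fun h => bot.kernel_of_complete_of_conservative h bot_conservative, fun h => bot.complete_of_kernel h⟩

/-- At the thick end completeness is trivial … -/
theorem top_complete : top.Complete := le_rfl

/-- … and conservativity IS the kernel conjecture (the fate of every extension that is complete by
soft analysis: smooth data, ℝ_an,exp-definable data, and — by Knothe–Rosenblatt rearrangement plus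
resolution — ℝ_an-definable data; census §Decomposition D3). -/
theorem top_conservative_iff : top.Conservative ↔ KZKernelConjecture :=
  ⟨fun h => top.kernel_of_complete_of_conservative top_complete h, fun h => top.conservative_of_kernel h⟩

/-- Adjoining relators: the extension `relations ⊔ closure T` by a set `T` of value-`0` combinations
(every "sector" of the summit's kernel-modulo-sector cruxes). -/
def adjoin (T : Set FormalRep) (hT : ∀ t ∈ T, eval t = 0) : Extension :=
  ⟨relations ⊔ AddSubgroup.closure T, le_sup_left,
    sup_le relations_le_ker_eval_holds ((AddSubgroup.closure_le _).mpr fun t ht => by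
      rw [SetLike.mem_coe, AddMonoidHom.mem_ker]; exact hT t ht)⟩

/-- Conservativity of `adjoin T` is exactly "every relator of the sector is KZ-accessible"
(the sector cruxes); completeness is "Conjecture 1 modulo the sector". -/
theorem adjoin_conservative_iff (T : Set FormalRep) (hT : ∀ t ∈ T, eval t = 0) :
    (adjoin T hT).Conservative ↔ ∀ t ∈ T, t ∈ relations := by
  constructor
  · intro h t ht
    exact h (AddSubgroup.mem_sup_right (AddSubgroup.subset_closure ht))
  · intro h
    exact sup_le le_rfl ((AddSubgroup.closure_le _).mpr h)

end Extension

/-! ## §3 The meta-fact -/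

/-- **Meta-fact.** In a split `A ∧ B → T` with `A` provable and `T → B`, the piece `B` is
EQUIVALENT to `T`. Every "normal form ∧ decision" split of this crux has this shape with `A` a tree
theorem (Viu-Sos' semi-canonical reduction `KZ.semiCanonicalReduction_holds`; the cube–Nash normal
form in dimension `≤ 2`; `KZ.exists_isRational_equivalent_holds`), so its decision piece is ≡ crux. -/
theorem metaFact {A B T : Prop} (hA : A) (assembly : A → B → T) (hTB : T → B) : B ↔ T :=
  ⟨assembly hA, hTB⟩

/-! ## §4 D1 — the volume form (Viu-Sos / Cresson–Viu-Sos) -/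

/-- The crux is equivalent to the compact volume form of Cresson–Viu-Sos (2022, p. 326), a TREE
THEOREM (`kzPeriodConjecture'_iff_volumeConjectureCompact_holds`, resolution-free proof of Viu-Sos'
Thm. 1.1 in `KZVolumeConjectureProofs.lean`). So the decision piece of the split
"every representation ≡ ±[K, 1] (proved) ∧ equal-volume compact sets are KZ-equivalent" violates (c). -/
theorem crux_iff_volumeConjectureCompact : AlgebraicFormTarget ↔ volumeConjectureCompact :=
  kzPeriodConjecture'_iff_volumeConjectureCompact_holds

/-- The shared route item `VolumeForm` (stmt-3814; routes SymplecticScissors, SphericalSchlafli,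
HardSphereVirial, WeightFloor, HermiteRigidity's line) has a LANDED iff with the summit — (c) fails
mechanically ("no landed iff"). -/
theorem volumeForm_landed_iff :
    Summit.KontsevichZagierPeriods.KontsevichZagierPeriods.Theses.SymplecticScissors.VolumeForm ↔
      KontsevichZagierPeriods :=
  Summit.KontsevichZagierPeriods.HermiteRigidity.ReductionRigidity.volumeForm_iff_kontsevichZagierPeriods

/-- Hence `VolumeForm ↔ crux`. -/
theorem volumeForm_iff_crux :
    Summit.KontsevichZagierPeriods.KontsevichZagierPeriods.Theses.SymplecticScissors.VolumeForm ↔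
      AlgebraicFormTarget :=
  volumeForm_landed_iff.trans crux_iff_summit.symm

/-! ## §5 D2 — the π-localisation (route AyoubSpecialisation) -/

/-- The one decomposition in the tree that passes (a), (b) (assembly = induction on the exponent `N`,
landed `kzKernelConjecture_of_piLocalKernel_of_piCancellation`) and (c) (both pieces open, neither with a
landed iff): `crux ↔ PiLocalKernel ∧ PiCancellation`. It is route AyoubSpecialisation's THESIS (items
stmt-0541, stmt-0540); as an `Extension` it is the π-saturation of `relations`. Not filable on this
route (D-0019: an alternative decomposition of the same statement is a separate route; payload
`no_new_routes`; cone ⊇ AyoubSpecialisation's ⇒ DUPLICATE at the next audit). -/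
theorem crux_iff_piSplit : AlgebraicFormTarget ↔ (PiLocalKernel ∧ PiCancellation) :=
  crux_iff_summit.trans
    Summit.KontsevichZagierPeriods.AyoubSpecialisation.kontsevichZagierPeriods_iff_piLocalKernel_and_piCancellation

/-! ## §6 D8 — restriction classes: the zero form -/

/-- *Zero form* of Conjecture 1: every representation of the number `0` is null-equivalent. -/
def ZeroForm : Prop := ∀ ⦃n : ℕ⦄ (r : IntegralRep n), r.value = 0 → of r ∈ relations

/-- The crux gives the zero form (compare with the empty representation, which is a relation). -/
theorem zeroForm_of_crux (h : AlgebraicFormTarget) : ZeroForm := by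
  intro n r hr
  have hE : Equivalent r (IntegralRep.empty 0) := h r (IntegralRep.empty 0) (by rw [hr]; simp)
  have := relations.add_mem hE (IntegralRep.of_empty_mem_relations (n := 0))
  simpa [Equivalent] using this

/-- **The zero form is already the whole conjecture**: merge `r` and `−r'` into ONE representation
`R` (slabs at disjoint levels, domain additivity: `KZ.IntegralRep.exists_of_add_of_sub_of_mem_relations`);
by soundness `R` has value `0`; the zero form makes `[R]` a relation, hence `[r] − [r']` is one.
Consequence for decompositions: a "piece" of the form "Conjecture 1 restricted to a class of pairs"
is strictly below the crux only if the class misses some merged zero-representations — classes cut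
out by value (algebraic / zero), by sign of the integrand, by connectedness or boundedness of the
domain, or by dimension `≥ d₀` all contain them (after the tree's normal-form theorems), so such
restrictions are ≡ crux; only arithmetically thin classes (MZV words, Beta products, curve type) are
not, and those are the SECTORS of D0. -/
theorem crux_of_zeroForm (h : ZeroForm) : AlgebraicFormTarget := by
  intro n m r r' hv
  obtain ⟨N, R, hR⟩ := IntegralRep.exists_of_add_of_sub_of_mem_relations r r'.neg
  have hneg : of r' + of r'.neg ∈ relations :=
    of_add_of_mem_relations_of_eqOn_neg (r := r') (r' := r'.neg) rfl fun _ _ => rfl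
  have hval : R.value = 0 := by
    have hk := relations_le_ker_eval_holds hR
    rw [AddMonoidHom.mem_ker, map_sub, map_add, eval_of, eval_of, eval_of,
      IntegralRep.value_neg, hv] at hk
    linarith
  have hR0 : of R ∈ relations := h R hval
  have : of r - of r' = (of r + of r'.neg - of R) + of R - (of r' + of r'.neg) := by abel
  rw [show Equivalent r r' ↔ of r - of r' ∈ relations from Iff.rfl, this]
  exact relations.sub_mem (relations.add_mem hR hR0) hneg

/-- `ZeroForm ↔ crux`. -/
theorem zeroForm_iff_crux : ZeroForm ↔ AlgebraicFormTarget := ⟨crux_of_zeroForm, zeroForm_of_crux⟩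

end Summit.KontsevichZagierPeriods.KontsevichZagierPeriods.Cruxes.AlgebraicFormTarget.Census

end
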